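import Summits.ABC.IUTFork.Cor312UnitCosetThm311
import HarnessLib

/-!
# [IUTchIII] Cor. 3.12 — the COSET test model, V-a: valuation-ball volumes — situation and typed Theorem 3.11 of the COARSE-FRAME coset bed

Record-only file (D-0012; MODEL DATA `bvol`/`kData`/`kLine`/`kColumn`/`kSituation`/`kFull`, then proofs; no `Prop` fact, nothing asserted
about print) of the abc-iut cell (wave-4 prover abc-iut-w4-d101, gen 5 — author lineage of the countermodel of record
`PinnedWitness.pinned_countermodel` p419720 and of the U/COSET models p429139–p435157). TAKES NO SIDE on [IUTchIII] Cor. 3.12. First half of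
the answer to abc-iut-rp-cx XREAD-4 §2 MODEL-SPACE LIMIT #5 («no j²-exact, KummerB-honest bed with a MOVING/inflating orbit that contains the
q-region») on abc-iut-rp-plan's «GO w4-d101 #5» (2026-08-26T09:49:51Z, D4: hull-level scope only).

Part I's coset machinery (`UnitCoset.coset`/`pair`/`Adm'`, p431339: over the `p`-adic UNIT shells the Θ-pilot Kummer images are the sign pairs
`±q^{j²}(1+p𝒪)`, which the unit indeterminacies (Ind2) genuinely MOVE) with ONE field changed: the pair `±c(1+p𝒪)` is given the log-volume
`bvol := −v_p(c)·log p` of its VALUATION BALL (part I: `−(v_p(c)+1)·log p`). Still monotone and unit-invariant (`bvol_mono`, `bvol_image`),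
so the typed [IUTchIII] Theorem 3.11 (i)–(iii) HOLDS verbatim (`kFull_statement`; `kColumn_kummerB`; Step (x) invariance `kLine_hAdm` /
`kLine_logvolInvariant`); the splitting monoids and Kummer images ARE part I's (`kLine_Psi`, `kColumn_frobΨ`, by `rfl`). With this volume the
Θ-pilot region at label `j` weighs EXACTLY `j²` q-regions (sequel `Cor312UnitCosetCoarse`: the setting with abc-iut-w4-d103's coarse frame
`{𝒪, q𝒪}`, pins, honesty checklist, Licence/GapH3/Statement-with-equality, ¬S ∀ q-data). One place (`toyIndex`, `l⋇ = 2`); a model of the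
typed interface, not of initial Θ-data; no judgement on print. [claim: Mochizuki2012, status: disputed] [cite: ScholzeStix2018, §2.2 pp. 9–10]
-/

noncomputable section

namespace Summit.ABC.IUTFork.Cor312Vol.UnitCosetCoarse

open Set Thm311 Cor312 Cor312.Checks Cor312.IdentifiedNonVacuity NaiveWitness UnitWitness UnitCoset Literature.IUT.LogThetaLattice

variable (p : ℕ) [hp : Fact p.Prime]

/-! ## 1. The valuation-ball log-volume on balls and pairs -/

open scoped Classical in
omit hp in
/-- **Log-volume** `μ(B_k) = −k·log p`, `μ(±c(1+p𝒪)) := −v_p(c)·log p` — the volume of the VALUATION BALL `B_{v(c)}` of the pair (so that the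
Θ-pilot region `±q^{j²}(1+p𝒪)` weighs exactly `j²` q-regions), `0` elsewhere. MODEL DATA. [claim: Mochizuki2012, status: disputed] -/
def bvol (j : toyIndex.Label) (vQ : toyIndex.VQ) (A : Set ((unitShells p).Packet j vQ)) : ℝ :=
  if h : ∃ k : ℤ, A = uBall p j vQ k then -(h.choose : ℝ) * Real.log p
  else if h' : ∃ c : ℚ, c ≠ 0 ∧ A = pair p j vQ c then -(padicValRat p h'.choose : ℝ) * Real.log p else 0

/-- `μ(B_k) = −k·log p`. [folklore] -/
theorem bvol_uBall (j : toyIndex.Label) (vQ : toyIndex.VQ) (k : ℤ) : bvol p j vQ (uBall p j vQ k) = -(k : ℝ) * Real.log p := by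
  classical
  have h : ∃ k' : ℤ, uBall p j vQ k = uBall p j vQ k' := ⟨k, rfl⟩
  unfold bvol
  rw [dif_pos h, uBall_injective p j vQ h.choose_spec.symm]

/-- `μ(±c(1+p𝒪)) = −v(c)·log p`. [folklore] -/
theorem bvol_pair (j : toyIndex.Label) (vQ : toyIndex.VQ) {c : ℚ} (hc : c ≠ 0) :
    bvol p j vQ (pair p j vQ c) = -(padicValRat p c : ℝ) * Real.log p := by
  classical
  have h1 : ¬ ∃ k : ℤ, pair p j vQ c = uBall p j vQ k := fun ⟨k, hk⟩ => pair_ne_uBall p j vQ hc k hk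
  have h2 : ∃ c' : ℚ, c' ≠ 0 ∧ pair p j vQ c = pair p j vQ c' := ⟨c, hc, rfl⟩
  unfold bvol
  rw [dif_neg h1, dif_pos h2, val_eq_of_pair_eq p hc h2.choose_spec.2.symm]

/-- **Monotone log-volume** on the admissible regions (balls and pairs). [folklore] -/
theorem bvol_mono {j : toyIndex.Label} {vQ : toyIndex.VQ} {A B : Set ((unitShells p).Packet j vQ)} (hA : Adm' p j vQ A)
    (hB : Adm' p j vQ B) (hAB : A ⊆ B) : bvol p j vQ A ≤ bvol p j vQ B := by
  have hlog := log_p_pos p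
  rcases hA with ⟨k, rfl⟩ | ⟨c, hc, rfl⟩ <;> rcases hB with ⟨k', rfl⟩ | ⟨c', hc', rfl⟩
  · rw [bvol_uBall, bvol_uBall, ← uVol_uBall, ← uVol_uBall]
    exact uVol_mono p hAB
  · exact absurd hAB (not_uBall_subset_pair p j vQ hc' k)
  · rw [bvol_pair p j vQ hc, bvol_uBall]
    have h : (k' : ℝ) ≤ padicValRat p c := by exact_mod_cast (pair_subset_uBall_iff p j vQ hc k').1 hAB
    nlinarith
  · rw [bvol_pair p j vQ hc, bvol_pair p j vQ hc']
    have h1 := (val_of_mem_pair p hc' (hAB (rep_mem_pair p j vQ c))).2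
    rw [LinearEquiv.apply_symm_apply] at h1
    rw [h1]

/-- The log-volume is invariant under a family acting by units. [folklore] -/
theorem bvol_image {Φ : (unitShells p).PacketAut} (h : ActsByUnits p Φ) (j : toyIndex.Label) (vQ : toyIndex.VQ)
    (A : Set ((unitShells p).Packet j vQ)) : bvol p j vQ (Φ j vQ '' A) = bvol p j vQ A := by
  classical
  obtain ⟨ε, hε, hΦ⟩ := h.unit j vQ
  by_cases hA : Adm' p j vQ A
  · rcases hA with ⟨k, rfl⟩ | ⟨c, hc, rfl⟩
    · rw [image_uBall_of_actsByUnits h]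
    · rw [image_pair_of_unit p hε hΦ, bvol_pair p j vQ (mul_ne_zero hε.1 hc), bvol_pair p j vQ hc,
        padicValRat.mul hε.1 hc, hε.2, zero_add]
  · have hA' : ¬ Adm' p j vQ (Φ j vQ '' A) := fun h' => hA ((adm'_image_iff p h j vQ A).1 h')
    unfold bvol
    rw [dif_neg (fun h1 => hA' (Or.inl h1)), dif_neg (fun h2 => hA' (Or.inr h2)), dif_neg (fun h1 => hA (Or.inl h1)),
      dif_neg (fun h2 => hA (Or.inr h2))]

/-! ## 2. Data, lines, columns, situation; the typed Theorem 3.11 -/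

omit hp in
/-- **The data (a)(b)(c) of line `0`**: part I's `cData` with the log-volume `bvol`. MODEL DATA. [claim: Mochizuki2012, status: disputed] -/
def kData : MRData (unitShells p) where
  shellPk := fun j vQ => uBall p j vQ 0
  shellSub := fun j v => uBall p j (toyIndex.over v) 0
  Adm := fun j vQ A => Adm' p j vQ A
  logvol := fun j vQ A => bvol p j vQ A
  Ψ := fun v _ => Psi p v
  act := fun v _ y => LinearMap.pi fun j => (line j.1 (toyIndex.over v) (y j)) • LinearMap.proj j
  Mmod := fun _ => Set.univ

/-- **Line `n`**: the transport of the line-`0` data by the unit `u₀^n` (part I's `lineFam`). MODEL DATA. [claim: Mochizuki2012, status: disputed] -/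
def kLine (n : ℤ) : MRData (unitShells p) := (kData p).map (lineFam p n)

/-- The admissible regions of every line are the balls and the pairs. [folklore] -/
theorem kLine_adm_iff (n : ℤ) (j : toyIndex.Label) (vQ : toyIndex.VQ) (A : Set ((unitShells p).Packet j vQ)) :
    (kLine p n).Adm j vQ A ↔ Adm' p j vQ A :=
  adm'_image_iff p (lineFam_actsByUnits p n).inv j vQ A

/-- The log-volume of every line is `bvol`. [folklore] -/
theorem kLine_logvol (n : ℤ) (j : toyIndex.Label) (vQ : toyIndex.VQ) (A : Set ((unitShells p).Packet j vQ)) :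
    (kLine p n).logvol j vQ A = bvol p j vQ A :=
  bvol_image p (lineFam_actsByUnits p n).inv j vQ A

/-- The integral structure of line `n` is `B_0`. [folklore] -/
theorem kLine_shellPk (n : ℤ) (j : toyIndex.Label) (vQ : toyIndex.VQ) : (kLine p n).shellPk j vQ = uBall p j vQ 0 :=
  image_uBall_of_actsByUnits (lineFam_actsByUnits p n) j vQ 0

/-- The number-field copy of line `n` is everything. [folklore] -/
theorem kLine_Mmod (n : ℤ) (j : toyIndex.LabelStar) : (kLine p n).Mmod j = Set.univ :=
  Set.image_univ_of_surjective ((unitShells p).globalAut (lineFam p n) j.1).surjective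

/-- The splitting monoid of line `n` IS part I's (only the volume changed). [folklore] -/
theorem kLine_Psi (n : ℤ) : (kLine p n).Ψ = (cLine p n).Ψ := rfl

/-- **Step (x) invariance, admissibility half**: every (Ind1)/(Ind2) family preserves the admissible class of a line. [folklore] -/
theorem kLine_hAdm (n : ℤ) : ∀ Φ ∈ (unitShells p).Ind1Family ∪ (unitShells p).Ind2Family,
    ∀ (j : toyIndex.Label) (vQ : toyIndex.VQ) (B : Set ((unitShells p).Packet j vQ)),
      (kLine p n).Adm j vQ B ↔ (kLine p n).Adm j vQ (Φ j vQ '' B) := by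
  intro Φ hΦ j vQ B
  rw [kLine_adm_iff, kLine_adm_iff, adm'_image_iff p (actsByUnits_of_mem_closure (Subgroup.subset_closure hΦ))]

/-- **Step (x) invariance, volume half**: `LogvolInvariant` for every line. [folklore] -/
theorem kLine_logvolInvariant (n : ℤ) : (kLine p n).LogvolInvariant := by
  intro Φ hΦ j vQ A _
  rw [kLine_logvol, kLine_logvol]
  exact bvol_image p (actsByUnits_of_mem_closure (Subgroup.subset_closure (show Φ ∈ _ ∪ _ from hΦ))) j vQ A

omit hp in
/-- **The COARSE-COSET SITUATION** (global degrees as in part I). MODEL DATA (an `abbrev`). [claim: Mochizuki2012, status: disputed] -/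
abbrev kSituation : Situation toyIndex where
  L := unitShells p
  D := kLine p
  G := fun _ j => cDegrees p j

omit hp in
/-- **The column `n`**: the line-`n` data read through abc-iut-w5-d247's sign twist `(−1)^m` (part I's `cColumn` with `bvol`). MODEL DATA.
[claim: Mochizuki2012, status: disputed] -/
def kColumn (n : ℤ) : Column (unitShells p) where
  frobAdm := fun m j vQ A => Adm' p j vQ ((twist m : (unitShells p).PacketAut) j vQ '' A)
  frobLogvol := fun m j vQ A => bvol p j vQ ((twist m : (unitShells p).PacketAut) j vQ '' A)
  frobΨ := fun m v hv => (unitShells p).starAut (twist m) v '' (kLine p n).Ψ v hv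
  frobMmod := fun m j => (unitShells p).globalAut (twist m) j.1 '' (kLine p n).Mmod j
  unitImage := fun _ m' j vQ => uBall p j vQ ((m' : ℤ) + 1)
  ballImage := fun _ j vQ => uBall p j vQ 0
  ObjLGP := ℤ
  frobObjLGP := FrobObj
  kumLGP := kum
  ObjLgp := ℤ
  frobObjLgp := FrobObj
  kumLgp := kum
  thetaPilot := fun m => ⟨(1, m), rfl⟩

/-- The Kummer images `frobΨ m` of the column ARE part I's (same splitting monoids, same twist). [folklore] -/
theorem kColumn_frobΨ (n m : ℤ) : (kColumn p n).frobΨ m = (cColumn p n).frobΨ m := rfl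

omit hp in
/-- **The full situation of the coarse-coset bed.** MODEL DATA (an `abbrev`). [claim: Mochizuki2012, status: disputed] -/
abbrev kFull : FullSituation toyIndex where
  toSituation := kSituation p
  col := kColumn p
  link := naiveLink

/-- **Thm. 3.11 (i) `MultiradialCompat`** through genuine (Ind2)-moves (line `n` is one move away from line `0`). [folklore] -/
theorem k_multiradialCompat : (kFull p).MultiradialCompat := fun n n' =>
  (MRData.RLGP_eq_iff _ _).2
    (Relation.EqvGen.trans _ _ _
      (Relation.EqvGen.symm _ _ (Relation.EqvGen.rel _ _ ⟨lineFam p n, Or.inr (lineFam_mem_Ind2Family p n), rfl⟩))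
      (Relation.EqvGen.rel _ _ ⟨lineFam p n', Or.inr (lineFam_mem_Ind2Family p n'), rfl⟩))

/-- (i): sub-packets, degree clause on the balls, multiradial compatibility. [folklore] -/
theorem k_partI : (kFull p).PartI := by
  refine ⟨fun n v hv x _ j => ?_, fun n j k => ⟨fun vQ => (kLine_adm_iff p n _ vQ _).2 (Or.inl ⟨k, rfl⟩), Set.toFinite _, ?_⟩,
    k_multiradialCompat p⟩
  · show x j ∈ signShells.SubPacket j.1 v
    rw [subPacket_eq_top]; trivial
  · rw [finsum_unique]
    exact ((kLine_logvol p n j.1 _ _).trans (bvol_uBall p j.1 _ k)).symm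

/-- **(ii) (b) KummerB** for every column. [folklore] -/
theorem kColumn_kummerB (n : ℤ) : (kColumn p n).KummerB (kLine p n) := by
  intro m v hv
  show (unitShells p).starAut (twist m) v '' ((unitShells p).starAut (lineFam p n) v '' Psi p v) =
    (unitShells p).starAut (lineFam p n) v '' Psi p v
  rw [(twist_actsByUnits p m).image_starAut_comm (lineFam_actsByUnits p n)]
  exact congrArg _ (image_Psi_of_actsBySigns p (twist_actsBySigns m) v)

/-- (ii): KummerA by unit-invariance of class and volume; KummerB; KummerC; (Ind3). [folklore] -/
theorem k_partII : (kFull p).toLatticeSituation.PartII := by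
  intro n
  refine (Column.partII_iff _ _).2 ⟨fun m j vQ A hA => ⟨?_, ?_⟩, kColumn_kummerB p n, fun m j => ?_, ?_⟩
  · exact (adm'_image_iff p (twist_actsByUnits p m) j vQ A).2 ((kLine_adm_iff p n j vQ A).1 hA)
  · exact (bvol_image p (twist_actsByUnits p m) j vQ A).trans (kLine_logvol p n j vQ A).symm
  · show (unitShells p).globalAut (twist m) j.1 '' (kLine p n).Mmod j = (kLine p n).Mmod j
    exact (congrArg _ (kLine_Mmod p n j)).trans
      ((Set.image_univ_of_surjective ((unitShells p).globalAut (twist m) j.1).surjective).trans (kLine_Mmod p n j).symm)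
  · refine ⟨fun m m' j vQ _ => ?_, fun m j vQ h => absurd trivial h⟩
    exact (uBall_mono p j vQ (show (0 : ℤ) ≤ (m' : ℤ) + 1 by omega)).trans (kLine_shellPk p n j vQ).symm.subset

/-- (iii): as for part I (same link data). [folklore] -/
theorem k_partIII : (kFull p).PartIII := by
  refine ⟨naiveLink.partIIIa_holds, naiveLink.partIIIb_holds, ?_, ?_,
    (kFull p).evalCompatUpToInd_of_multiradialCompat (k_multiradialCompat p)⟩
  · refine naiveLink.partIIIc_of_full (fun _ => rfl) fun n m => ?_
    rintro _ ⟨a, rfl⟩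
    show unitIso a ≪≫ unitIso ((-1) ^ m.natAbs) = unitIso ((-1) ^ m.natAbs) ≪≫ unitIso a
    rw [unitIso_trans, unitIso_trans, mul_comm]
  · intro n m; exact Thm311.PolyIsoCalc.stabilized_full _ _

/-- **The typed [IUTchIII] Theorem 3.11 (i) ∧ (ii) ∧ (iii) HOLDS in the coarse-coset bed.** [folklore] -/
theorem kFull_statement : (kFull p).Statement := ⟨k_partI p, k_partII p, k_partIII p⟩

end Summit.ABC.IUTFork.Cor312Vol.UnitCosetCoarse

end
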